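import Literature.Analysis.FluidPDE.PerturbedNSFourierIteration
import HarnessLib

/-!
# Symmetries of the Fourier-side solution of the perturbed Navier–Stokes system

Analysis/FluidPDE proof file, sequel of `PerturbedNSFourierIteration` in the chain
`PerturbedNSFourier*` (short-time smooth solutions of
`∂ₜv + (v·∇)v + (u·∇)v + (v·∇)u + ∇q = νΔv`, `div v = 0`, `v(0) = v₀` around a smooth
divergence-free background on `T^d`, `#d ≤ 3`; Majda–Bertozzi 2002, Thm. 3.4; Cheskidov–Luo
2022, §3.1 (3.2)). Three structural properties of the Picard limit `c = picardLim` under the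
threshold hypotheses `BallHyp`:

* **divergence freedom on the Fourier side**, `∑ₗ kₗ c(l, t, k) = 0`, read off the fixed-point
  equation `c = Φ(c)` (`sum_intCast_mul_picardLim`): the datum is Fourier-divergence free and
  the Duhamel map integrates the *projected* symbol, `∑ₗ kₗ (P G)ₗ = 0`
  (`CorrectorFourier.sum_intCast_mul_projSym`);
* **vanishing of the zero mode**, `c(l, t, 0) = 0` (`picardLim_zero_freq`), i.e. zero spatial
  mean of the velocity (Cheskidov–Luo 2022, §3.1: "(3.2) preserves the zero-mean condition"):
  the datum has zero mode zero and at `k = 0` the projected symbol vanishes for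
  Fourier-divergence-free drift and field (`projSym_zero_freq_four`);
* **conjugation symmetry**, `c(l, t, -k) = conj c(l, t, k)` (`iter_conjSymm`,
  `picardLim_conjSymm`), i.e. reality of the synthesized field, inherited along the iteration
  from the real data (`Uⱼ(-m) = conj Uⱼ(m)`, `a(l,-m) = conj a(l,m)`;
  `CorrectorFourier.projSym_neg_eq_conj`, the heat factor being real and even).

## References

* A. Cheskidov, X. Luo, arXiv:2009.06596, §3.1 (3.2). [`CheskidovLuo2022`]
* L. Grafakos, *Classical Fourier Analysis*, 3rd ed. (2014), Prop. 3.2.5. [`Grafakos2014`]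
-/

noncomputable section

open MeasureTheory Real Set Filter Topology UnitAddTorus

namespace Literature.Analysis.FluidPDE

namespace PerturbedNSFourier

open scoped ComplexConjugate
open ScalarFourier
open CorrectorFourier (leraySym projSym sum_intCast_mul_projSym projSym_neg_eq_conj)
open FourierNS (HasDecay clamp)
open Literature.Analysis.FunctionSpaces.Torus (freqNormSq)

variable {d : Type*} [Fintype d] [DecidableEq d]
variable {ν θ : ℝ} {U : d → ℝ → (d → ℤ) → ℂ} {a : d → (d → ℤ) → ℂ} {Z ρ A : ℝ}

/-! ### Divergence freedom on the Fourier side -/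

section DivFree

/-- **The Duhamel map produces Fourier-divergence-free fields from a Fourier-divergence-free
datum**: `∑ₗ kₗ Φ(c)(l, t, k) = 0` for every `c` continuous in time with uniform order-four
decay, if `∑ₗ kₗ a(l, k) = 0` (the integrand is the projected symbol,
`CorrectorFourier.sum_intCast_mul_projSym`; adapted from
`LinearisedNSFourier.PicardHyp.sum_intCast_mul_picardMap`). [folklore] -/
theorem BallHyp.sum_intCast_mul_picardMap (h : BallHyp ν θ U a Z ρ A)
    (hadiv : ∀ k, ∑ l, (k l : ℂ) * a l k = 0) {c : d → ℝ → (d → ℤ) → ℂ} {X : ℝ}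
    (hcc : ∀ l m, Continuous fun t => c l t m) (hc : ∀ l t, HasDecay 4 X (c l t))
    (t : ℝ) (k : d → ℤ) : ∑ l, (k l : ℂ) * picardMap ν θ U a c l t k = 0 := by
  set τ := clamp θ t with hτdef
  have hi : ∀ l, IntervalIntegrable (fun s => (heatFactor ν k (τ - s) : ℂ) *
      projSym (fun j => U j s) 0 (fun j => c j s) l k) volume 0 τ := fun l =>
    (h.continuous_integrand hcc hc l k τ).intervalIntegrable _ _
  have hdat : ∑ l, (k l : ℂ) * ((heatFactor ν k τ : ℂ) * a l k) = 0 := by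
    calc ∑ l, (k l : ℂ) * ((heatFactor ν k τ : ℂ) * a l k)
        = (heatFactor ν k τ : ℂ) * ∑ l, (k l : ℂ) * a l k := by
          rw [Finset.mul_sum]
          refine Finset.sum_congr rfl fun l _ => ?_
          ring
      _ = 0 := by rw [hadiv k, mul_zero]
  simp only [picardMap, ← hτdef, mul_sub, Finset.sum_sub_distrib, hdat, zero_sub, neg_eq_zero]
  simp_rw [← intervalIntegral.integral_const_mul]
  rw [← intervalIntegral.integral_finsetSum fun l _ => (hi l).const_mul _]
  have hzero : ∀ s, ∑ l, (k l : ℂ) * ((heatFactor ν k (τ - s) : ℂ) *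
      projSym (fun j => U j s) 0 (fun j => c j s) l k) = 0 := by
    intro s
    have h0 := sum_intCast_mul_projSym (fun j => U j s) 0 (fun j => c j s) k
    calc ∑ l, (k l : ℂ) * ((heatFactor ν k (τ - s) : ℂ) *
          projSym (fun j => U j s) 0 (fun j => c j s) l k)
        = (heatFactor ν k (τ - s) : ℂ) *
            ∑ l, (k l : ℂ) * projSym (fun j => U j s) 0 (fun j => c j s) l k := by
          rw [Finset.mul_sum]
          refine Finset.sum_congr rfl fun l _ => ?_
          ring
      _ = 0 := by rw [h0, mul_zero]
  have hfun : (fun s => ∑ l, (k l : ℂ) * ((heatFactor ν k (τ - s) : ℂ) *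
      projSym (fun j => U j s) 0 (fun j => c j s) l k)) = fun _ => 0 := funext hzero
  rw [hfun, intervalIntegral.integral_zero]

/-- **The Picard limit is Fourier-divergence free** when the datum is:
`∑ₗ kₗ c(l, t, k) = 0` (`div v(t) = 0` propagates from `div v₀ = 0`; read off `c = Φ(c)`). [folklore] -/
theorem BallHyp.sum_intCast_mul_picardLim (h : BallHyp ν θ U a Z ρ A)
    (hadiv : ∀ k, ∑ l, (k l : ℂ) * a l k = 0) (t : ℝ) (k : d → ℤ) :
    ∑ l, (k l : ℂ) * picardLim ν θ U a l t k = 0 := by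
  have hcc : ∀ l m, Continuous fun t => picardLim ν θ U a l t m := h.continuous_picardLim
  have hfix : ∀ l, picardLim ν θ U a l t k = picardMap ν θ U a (picardLim ν θ U a) l t k := fun l =>
    h.picardLim_eq_picardMap l t k
  simp_rw [hfix]
  exact h.sum_intCast_mul_picardMap hadiv hcc h.hasDecay_picardLim t k

end DivFree

/-! ### The zero mode -/

section ZeroMode

/-- **The Picard limit has vanishing zero mode** (zero spatial mean of the synthesized
velocity, propagated from the datum; Cheskidov–Luo 2022, §3.1: "(3.2) preserves the zero-mean
condition"): if `a(l, 0) = 0`, the drift coefficients are Fourier-divergence free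
(`∑ⱼ mⱼ Uⱼ(t, m) = 0`, from `div u = 0`) and the datum is, then `c(l, t, 0) = 0` — at the
zero frequency the heat factor multiplies `a(l,0) = 0` and the projected symbol vanishes
(`projSym_zero_freq_four`, using the divergence freedom of `c` itself). [folklore] -/
theorem BallHyp.picardLim_zero_freq (h : BallHyp ν θ U a Z ρ A) (ha0 : ∀ l, a l 0 = 0)
    (hadiv : ∀ k, ∑ l, (k l : ℂ) * a l k = 0) (hUdiv : ∀ t m, ∑ j, (m j : ℂ) * U j t m = 0)
    (l : d) (t : ℝ) : picardLim ν θ U a l t 0 = 0 := by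
  have hcdiv : ∀ s m, ∑ j, (m j : ℂ) * picardLim ν θ U a j s m = 0 := h.sum_intCast_mul_picardLim hadiv
  rw [h.picardLim_eq_picardMap l t 0, picardMap]
  have hzero : ∀ s, projSym (fun j => U j s) 0 (fun j => picardLim ν θ U a j s) l 0 = 0 := fun s =>
    projSym_zero_freq_four h.hZ (fun j => h.hU4 j s) (fun j => h.hasDecay_picardLim j s) (hUdiv s)
      (hcdiv s) l
  simp_rw [hzero, mul_zero, intervalIntegral.integral_zero, sub_zero, ha0 l, mul_zero]

end ZeroMode

/-! ### Conjugation symmetry (reality) -/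

section Conj

/-- **The Duhamel map preserves conjugation symmetry** for conjugate-symmetric data (the heat
factor is real and even in the frequency; the projected symbol of conjugate-symmetric fields
is conjugate symmetric, `CorrectorFourier.projSym_neg_eq_conj`; Mathlib
`intervalIntegral_conj`). [folklore] -/
theorem picardMap_neg_eq_conj (hU : ∀ j t m, U j t (-m) = conj (U j t m))
    (ha : ∀ l m, a l (-m) = conj (a l m)) {c : d → ℝ → (d → ℤ) → ℂ}
    (hc : ∀ j t m, c j t (-m) = conj (c j t m)) (l : d) (t : ℝ) (k : d → ℤ) :
    picardMap ν θ U a c l t (-k) = conj (picardMap ν θ U a c l t k) := by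
  have hR : ∀ (i j : d) (m : d → ℤ), (0 : d → d → (d → ℤ) → ℂ) i j (-m) =
      conj ((0 : d → d → (d → ℤ) → ℂ) i j m) := fun i j m => by simp
  have hheat0 : heatFactor ν (-k) (clamp θ t) = heatFactor ν k (clamp θ t) := by
    simp [heatFactor_apply, heatRate_apply, FunctionSpaces.Torus.freqNormSq_neg]
  simp only [picardMap]
  rw [map_sub, map_mul, Complex.conj_ofReal, hheat0, ha l k, ← intervalIntegral.intervalIntegral_conj]
  congr 1
  refine intervalIntegral.integral_congr fun s _ => ?_
  have hheat : heatFactor ν (-k) (clamp θ t - s) = heatFactor ν k (clamp θ t - s) := by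
    simp [heatFactor_apply, heatRate_apply, FunctionSpaces.Torus.freqNormSq_neg]
  simp only [map_mul, Complex.conj_ofReal, hheat]
  rw [projSym_neg_eq_conj (fun j m => hU j s m) (hR) (fun j m => hc j s m) l k]

/-- **The iterates are conjugate symmetric** for conjugate-symmetric data. [folklore] -/
theorem iter_conjSymm (hU : ∀ j t m, U j t (-m) = conj (U j t m))
    (ha : ∀ l m, a l (-m) = conj (a l m)) (n : ℕ) (l : d) (t : ℝ) (k : d → ℤ) :
    picardIter ν θ U a n l t (-k) = conj (picardIter ν θ U a n l t k) := by
  induction n generalizing l t k with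
  | zero => simp
  | succ n ih =>
    rw [picardIter_succ]
    exact picardMap_neg_eq_conj hU ha (fun j t m => ih j t m) l t k

/-- **The Picard limit is conjugate symmetric**: `c(l, t, -k) = conj c(l, t, k)` (pointwise
limit of the conjugate-symmetric iterates). [folklore] -/
theorem BallHyp.picardLim_conjSymm (h : BallHyp ν θ U a Z ρ A) (hU : ∀ j t m, U j t (-m) = conj (U j t m))
    (ha : ∀ l m, a l (-m) = conj (a l m)) (l : d) (t : ℝ) (k : d → ℤ) :
    picardLim ν θ U a l t (-k) = conj (picardLim ν θ U a l t k) := by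
  obtain ⟨-, -, htend, -, -⟩ := h.iter_tendsto
  have h1 : Tendsto (fun n => picardIter ν θ U a n l t (-k)) atTop (𝓝 (conj (picardLim ν θ U a l t k))) := by
    simp_rw [iter_conjSymm hU ha]
    exact (Complex.continuous_conj.tendsto _).comp (htend l t k)
  exact tendsto_nhds_unique (htend l t (-k)) h1

end Conj

end PerturbedNSFourier

end Literature.Analysis.FluidPDE

end
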